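import Summits.NavierStokesRegularity.NavierStokesRegularity.Theorems.TypeICertificateLadderNoTypeIBlowupLemma35
import Literature.Analysis.FluidPDE.ClassicalSuitable
import Literature.Analysis.FluidPDE.LocalLeraySolutions
import Literature.Analysis.FluidPDE.SereginSverakOffAxisTools
import Literature.Analysis.FluidPDE.SereginSverakBlowupLimit

/-!
# `TypeIConcentration` (stmt-NavierStokesRegularity-2881), line `bp-scaled-energy`: the pressure
# gauge alone forces the range of scales of the vertex stub to depend on the data

Negative (support) lemma for the crux `TypeICertificateLadder.TypeIConcentration` (cdisprove seat,
generation 4; theorems only), companion of `VertexStubParasitic.lean`. The registered stub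
`stub_scaledEnergyVertexEventually` of `Cruxes/TypeIConcentration/Lines/bp-scaled-energy.lean` uses
Seregin–Šverák's pressure functional `D(0, r; q) = r⁻² ∫_{Q(0,r)} |q|^{3/2}` with NO MEAN
SUBTRACTED. Hence already in the trivial velocity class `v ≡ 0` — admissible at EVERY level
`K ≥ 0`, with the constant pressure `q ≡ λ` (a suitable weak solution in `Q(0,1)`,
`constPressure_isSuitableWeakSolutionOn`; data `A = E = 0`, `D(0,1;λ) = |Q(0,1)| λ^{3/2} < ∞`) —
one has `D(0, r; λ) ≥ |B_r| λ^{3/2}` at every fixed scale (`le_pressureD_const`), unbounded in `λ`: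

* `vertexStub_false_of_dataFreeRange_gauge (hK : 0 ≤ K)` — the stub with `∃ r₁` moved in front of
  `∀ M'` is FALSE at every level `K ≥ 0` (including `K = 0`, where `VertexStubParasitic`'s witness
  degenerates), for the pressure term alone.

TWO INDEPENDENT OBSTRUCTIONS, for the provers: this GAUGE obstruction lives in `D` and disappears
if the slice mean `[q]_{𝒞(0,r)}(t)` is subtracted (or the pressure is normalised, as Tao's gauge
does in the zoom `zoom_unitCyl_data`); the PARASITIC obstruction of `VertexStubParasitic.lean` lives
in `C` (its pressure `-b′(t) x₁` is already mean-free on `𝒞(0,r)`) and survives any pressure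
normalisation. Both say: the unit-scale data enter the stub only through `r₁(K, M') ↓ 0`.
[cite: SereginSverak2009, §3 (definition of D, arXiv p. 9)] [cite: KochNadirashviliSereginSverak2009, §1 p. 3]
-/

noncomputable section

set_option linter.dupNamespace false

namespace Summit.NavierStokesRegularity.NavierStokesRegularity.Theorems.TypeIConcentration.Negative

open Set Filter Topology MeasureTheory Metric Function
open Literature.Analysis.FluidPDE Literature.Analysis.FluidPDE.SereginSverak2009
open scoped NNReal ENNReal InnerProductSpace RealInnerProductSpace Laplacian

/-- **Rest state with a constant pressure gauge**: `(v, q) = (0, λ)` is a suitable weak solution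
of unit-viscosity Navier–Stokes in `Q(0,1)` (smooth pair solving the system pointwise: every term
vanishes, `∇λ = 0`). [cite: CaffarelliKohnNirenberg1982, §2] -/
theorem constPressure_isSuitableWeakSolutionOn (lam : ℝ) :
    IsSuitableWeakSolutionOn (parCylOpens 0 1) 1 0
      (0 : ℝ → EuclideanSpace ℝ (Fin 3) → EuclideanSpace ℝ (Fin 3)) (fun _ _ => lam) := by
  refine isSuitableWeakSolutionOn_of_contDiffOn (S := univ) isOpen_univ
    (fun z _ => ⟨mem_univ _, mem_univ _⟩) contDiffOn_const contDiffOn_const continuousOn_const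
    (fun t _ x => ?_) (fun t _ x => ?_)
  · show timeDeriv (fun (_ : ℝ) (_ : EuclideanSpace ℝ (Fin 3)) => (0 : EuclideanSpace ℝ (Fin 3))) t x +
        convect (fun _ : EuclideanSpace ℝ (Fin 3) => (0 : EuclideanSpace ℝ (Fin 3)))
          (fun _ : EuclideanSpace ℝ (Fin 3) => (0 : EuclideanSpace ℝ (Fin 3))) x =
      (1 : ℝ) • (Δ (fun _ : EuclideanSpace ℝ (Fin 3) => (0 : EuclideanSpace ℝ (Fin 3)))) x -
        gradient (fun _ : EuclideanSpace ℝ (Fin 3) => lam) x + 0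
    rw [gradient_fun_const, InnerProductSpace.laplacian_const]
    simp [timeDeriv_apply, convect]
  · show VectorCalculus.divergence (fun _ : EuclideanSpace ℝ (Fin 3) => (0 : EuclideanSpace ℝ (Fin 3))) x = 0
    simp [VectorCalculus.divergence]

/-- **Lower bound on the pressure functional of a constant**: `D(0, r; λ) ≥ |B_r| λ^{3/2}` for
`λ ≥ 0`, `r > 0` (the sub-cylinder `]-r², 0[ × B_r ⊆ Q(0,r)` has volume `r² |B_r|`). [folklore] -/
theorem le_pressureD_const {lam r : ℝ} (hlam : 0 ≤ lam) (hr : 0 < r) :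
    ENNReal.ofReal lam ^ (3 / 2 : ℝ) * volume (ball (0 : EuclideanSpace ℝ (Fin 3)) r) ≤
      pressureD 0 r (fun (_ : ℝ) (_ : EuclideanSpace ℝ (Fin 3)) => lam) := by
  set S : Set (ℝ × EuclideanSpace ℝ (Fin 3)) := Ioo (-r ^ 2) 0 ×ˢ ball (0 : EuclideanSpace ℝ (Fin 3)) r
    with hS
  have hSsub : S ⊆ parCyl (0 : ℝ × EuclideanSpace ℝ (Fin 3)) r := by
    refine Subset.trans ?_ (parabolicCylinder_subset_parCyl r (0 : ℝ × EuclideanSpace ℝ (Fin 3)))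
    rintro z ⟨⟨h1, h2⟩, h3⟩
    rw [mem_parabolicCylinder, Prod.fst_zero, Prod.snd_zero]
    exact ⟨⟨by linarith, h2⟩, mem_ball.1 h3⟩
  have hvolS : volume S = ENNReal.ofReal (r ^ 2) * volume (ball (0 : EuclideanSpace ℝ (Fin 3)) r) := by
    rw [hS, Measure.volume_eq_prod, Measure.prod_prod, Real.volume_Ioo, sub_neg_eq_add, zero_add]
  have hr2 : ENNReal.ofReal (r ^ 2) ≠ 0 := by
    rw [ENNReal.ofReal_ne_zero_iff]
    positivity
  have henorm : ‖lam‖ₑ = ENNReal.ofReal lam := by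
    rw [← ofReal_norm, Real.norm_of_nonneg hlam]
  unfold pressureD
  calc ENNReal.ofReal lam ^ (3 / 2 : ℝ) * volume (ball (0 : EuclideanSpace ℝ (Fin 3)) r)
      = (ENNReal.ofReal r ^ 2)⁻¹ * (ENNReal.ofReal lam ^ (3 / 2 : ℝ) * volume S) := by
        rw [hvolS, ← ENNReal.ofReal_pow hr.le, mul_left_comm (ENNReal.ofReal lam ^ (3 / 2 : ℝ)),
          ← mul_assoc, ← mul_assoc, ENNReal.inv_mul_cancel hr2 ENNReal.ofReal_ne_top, one_mul]
    _ = (ENNReal.ofReal r ^ 2)⁻¹ * ∫⁻ _ in S, ‖lam‖ₑ ^ (3 / 2 : ℝ) := by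
        rw [setLIntegral_const, henorm]
    _ ≤ (ENNReal.ofReal r ^ 2)⁻¹ *
          ∫⁻ _ in parCyl (0 : ℝ × EuclideanSpace ℝ (Fin 3)) r, ‖lam‖ₑ ^ (3 / 2 : ℝ) :=
        mul_le_mul' le_rfl (lintegral_mono_set hSsub)

/-- **At every fixed scale the pressure functional of the admissible gauge family is unbounded**:
for `r > 0` and any level `d`, some `λ ≥ 1` gives `D(0, r; λ) > d`. [folklore] -/
theorem exists_lt_pressureD_const (d : ℝ≥0) {r : ℝ} (hr : 0 < r) :
    ∃ lam : ℝ, 1 ≤ lam ∧ (d : ℝ≥0∞) < pressureD 0 r (fun (_ : ℝ) (_ : EuclideanSpace ℝ (Fin 3)) => lam) := by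
  have hV0 : volume (ball (0 : EuclideanSpace ℝ (Fin 3)) r) ≠ 0 := (measure_ball_pos volume _ hr).ne'
  have hVtop : volume (ball (0 : EuclideanSpace ℝ (Fin 3)) r) ≠ ⊤ := measure_ball_lt_top.ne
  set V : ℝ := (volume (ball (0 : EuclideanSpace ℝ (Fin 3)) r)).toReal with hVdef
  have hVpos : 0 < V := ENNReal.toReal_pos hV0 hVtop
  set lam : ℝ := max 1 (((d : ℝ) + 1) / V) with hlam
  have hlam1 : 1 ≤ lam := le_max_left _ _
  have hlam0 : 0 ≤ lam := zero_le_one.trans hlam1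
  refine ⟨lam, hlam1, lt_of_lt_of_le ?_ (le_pressureD_const hlam0 hr)⟩
  -- `λ ≤ λ^{3/2}` for `λ ≥ 1`, and `λ |B_r| ≥ d + 1 > d`
  have h1 : (1 : ℝ≥0∞) ≤ ENNReal.ofReal lam := by
    rw [← ENNReal.ofReal_one]; exact ENNReal.ofReal_le_ofReal hlam1
  have hpow : ENNReal.ofReal lam ≤ ENNReal.ofReal lam ^ (3 / 2 : ℝ) := by
    calc ENNReal.ofReal lam = ENNReal.ofReal lam ^ (1 : ℝ) := (ENNReal.rpow_one _).symm
      _ ≤ ENNReal.ofReal lam ^ (3 / 2 : ℝ) := ENNReal.rpow_le_rpow_of_exponent_le h1 (by norm_num)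
  refine lt_of_lt_of_le ?_ (mul_le_mul' hpow le_rfl)
  rw [← ENNReal.ofReal_toReal hVtop, ← hVdef, ← ENNReal.ofReal_mul hlam0, ← ENNReal.ofReal_coe_nnreal,
    ENNReal.ofReal_lt_ofReal_iff (by positivity)]
  have h2 : ((d : ℝ) + 1) / V ≤ lam := le_max_right _ _
  rw [div_le_iff₀ hVpos] at h2
  linarith

/-- The data of the gauge family are finite: `A(0,3/4;0) + E(0,3/4;0) + D(0,1;λ) < ∞`. [folklore] -/
theorem constPressure_data_lt_top (lam : ℝ) :
    energyA 0 (3 / 4) (0 : ℝ → EuclideanSpace ℝ (Fin 3) → EuclideanSpace ℝ (Fin 3)) +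
      dissipationE 0 (3 / 4)
        (0 : ℝ → EuclideanSpace ℝ (Fin 3) → EuclideanSpace ℝ (Fin 3) →L[ℝ] EuclideanSpace ℝ (Fin 3)) +
      pressureD 0 1 (fun (_ : ℝ) (_ : EuclideanSpace ℝ (Fin 3)) => lam) < ∞ := by
  have hA : energyA 0 (3 / 4) (0 : ℝ → EuclideanSpace ℝ (Fin 3) → EuclideanSpace ℝ (Fin 3)) ≤ 0 := by
    unfold energyA
    exact essSup_le_of_ae_le 0 (Eventually.of_forall fun t => by simp)
  have hE : dissipationE 0 (3 / 4)
      (0 : ℝ → EuclideanSpace ℝ (Fin 3) → EuclideanSpace ℝ (Fin 3) →L[ℝ] EuclideanSpace ℝ (Fin 3)) = 0 := by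
    unfold dissipationE
    simp [frobeniusNormSq_zero]
  have hD : pressureD 0 1 (fun (_ : ℝ) (_ : EuclideanSpace ℝ (Fin 3)) => lam) < ∞ := by
    unfold pressureD
    rw [setLIntegral_const]
    exact ENNReal.mul_lt_top (ENNReal.inv_lt_top.2 (by simp))
      (ENNReal.mul_lt_top (ENNReal.rpow_lt_top_of_nonneg (by norm_num) enorm_ne_top)
        (volume_parCyl_lt_top 1))
  rw [nonpos_iff_eq_zero.1 hA, hE, zero_add, zero_add]
  exact hD

/-- **The range of scales must depend on the data — gauge version, every level `K ≥ 0`.** It is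
FALSE that some `K`-only level `d` bounds `A + E + C + D` for all Type-I(`K`) suitable weak
solutions in `Q(0,1)` on a `K`-only range `(0, r₁)`: the stub `stub_scaledEnergyVertexEventually`
with `∃ r₁` moved in front of `∀ M'` fails already on the rest state with a constant pressure
gauge `(0, λ)` (admissible at every `K ≥ 0`, finite data, `D(0, r₁/2; λ) ≥ |B_{r₁/2}| λ^{3/2} → ∞`).
The functional `D` subtracts no mean, so the pressure datum `D(0,1;q)` must enter `r₁`.
[cite: SereginSverak2009, §3 (definition of D, arXiv p. 9)] -/
theorem vertexStub_false_of_dataFreeRange_gauge {K : ℝ} (hK : 0 ≤ K) :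
    ¬ ∃ d : ℝ≥0, ∃ r₁ : ℝ, 0 < r₁ ∧ r₁ ≤ 1 / 4 ∧
      ∀ (v : ℝ → EuclideanSpace ℝ (Fin 3) → EuclideanSpace ℝ (Fin 3))
        (q : ℝ → EuclideanSpace ℝ (Fin 3) → ℝ)
        (G : ℝ → EuclideanSpace ℝ (Fin 3) → EuclideanSpace ℝ (Fin 3) →L[ℝ] EuclideanSpace ℝ (Fin 3)),
        IsSuitableWeakSolutionOn (parCylOpens 0 1) 1 0 v q →
        (∫⁻ z in parCyl 0 1, ‖v z.1 z.2‖ₑ ^ (3 : ℕ) < ∞) →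
        HasWeakSpatialGradientOn (parCylOpens 0 1) v G →
        (∀ᵐ z ∂(volume.restrict (parCyl 0 1)), Real.sqrt (-z.1) * ‖v z.1 z.2‖ ≤ K) →
        ∀ r ∈ Ioo (0 : ℝ) r₁,
          energyA 0 r v + dissipationE 0 r G + cubicC 0 r v + pressureD 0 r q ≤ d := by
  rintro ⟨d, r₁, hr₁, -, h⟩
  obtain ⟨lam, -, hlt⟩ := exists_lt_pressureD_const d (half_pos hr₁)
  have hL3 : ∫⁻ z in parCyl (0 : ℝ × EuclideanSpace ℝ (Fin 3)) 1,
      ‖(0 : ℝ → EuclideanSpace ℝ (Fin 3) → EuclideanSpace ℝ (Fin 3)) z.1 z.2‖ₑ ^ (3 : ℕ) < ∞ := by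
    simp
  have hrate : ∀ᵐ z ∂(volume.restrict (parCyl (0 : ℝ × EuclideanSpace ℝ (Fin 3)) 1)),
      Real.sqrt (-z.1) * ‖(0 : ℝ → EuclideanSpace ℝ (Fin 3) → EuclideanSpace ℝ (Fin 3)) z.1 z.2‖ ≤ K :=
    Eventually.of_forall fun z => by simpa using hK
  have hle := h 0 (fun _ _ => lam) 0 (constPressure_isSuitableWeakSolutionOn lam) hL3
    (hasWeakSpatialGradientOn_zero _) hrate (r₁ / 2) ⟨half_pos hr₁, half_lt_self hr₁⟩
  exact absurd (hlt.trans_le (le_trans le_add_self hle)) (lt_irrefl _)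

/-- The same at all scales WITH the data hypothesis: no `K`-only (`K ≥ 0`) bound on `A + E + C + D`
holds on ALL scales `0 < r < 1/4` for the admissible pairs with finite data — gauge version
(`(0, λ)`, `D(0, 1/8; λ) → ∞`). [cite: SereginSverak2009, §3 (definition of D, arXiv p. 9)] -/
theorem vertexStub_false_allScales_gauge {K : ℝ} (hK : 0 ≤ K) :
    ¬ ∃ d : ℝ≥0, ∀ M' : ℝ≥0∞, M' ≠ ⊤ →
      ∀ (v : ℝ → EuclideanSpace ℝ (Fin 3) → EuclideanSpace ℝ (Fin 3))
        (q : ℝ → EuclideanSpace ℝ (Fin 3) → ℝ)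
        (G : ℝ → EuclideanSpace ℝ (Fin 3) → EuclideanSpace ℝ (Fin 3) →L[ℝ] EuclideanSpace ℝ (Fin 3)),
        IsSuitableWeakSolutionOn (parCylOpens 0 1) 1 0 v q →
        (∫⁻ z in parCyl 0 1, ‖v z.1 z.2‖ₑ ^ (3 : ℕ) < ∞) →
        HasWeakSpatialGradientOn (parCylOpens 0 1) v G →
        (∀ᵐ z ∂(volume.restrict (parCyl 0 1)), Real.sqrt (-z.1) * ‖v z.1 z.2‖ ≤ K) →
        energyA 0 (3 / 4) v + dissipationE 0 (3 / 4) G + pressureD 0 1 q ≤ M' →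
        ∀ r ∈ Ioo (0 : ℝ) (1 / 4),
          energyA 0 r v + dissipationE 0 r G + cubicC 0 r v + pressureD 0 r q ≤ d := by
  rintro ⟨d, h⟩
  obtain ⟨lam, -, hlt⟩ := exists_lt_pressureD_const d (by norm_num : (0 : ℝ) < 1 / 8)
  have hL3 : ∫⁻ z in parCyl (0 : ℝ × EuclideanSpace ℝ (Fin 3)) 1,
      ‖(0 : ℝ → EuclideanSpace ℝ (Fin 3) → EuclideanSpace ℝ (Fin 3)) z.1 z.2‖ₑ ^ (3 : ℕ) < ∞ := by
    simp
  have hrate : ∀ᵐ z ∂(volume.restrict (parCyl (0 : ℝ × EuclideanSpace ℝ (Fin 3)) 1)),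
      Real.sqrt (-z.1) * ‖(0 : ℝ → EuclideanSpace ℝ (Fin 3) → EuclideanSpace ℝ (Fin 3)) z.1 z.2‖ ≤ K :=
    Eventually.of_forall fun z => by simpa using hK
  have hle := h _ (constPressure_data_lt_top lam).ne 0 (fun _ _ => lam) 0
    (constPressure_isSuitableWeakSolutionOn lam) hL3 (hasWeakSpatialGradientOn_zero _) hrate le_rfl
    (1 / 8) ⟨by norm_num, by norm_num⟩
  exact absurd (hlt.trans_le (le_trans le_add_self hle)) (lt_irrefl _)

end Summit.NavierStokesRegularity.NavierStokesRegularity.Theorems.TypeIConcentration.Negative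

end
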